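import Literature.Analysis.FluidPDE.HardSphereWindowCollisionCount
import Literature.Analysis.FluidPDE.HardSphereWindowCount
import HarnessLib

/-!
# Finite collision intensity of the hard-sphere flow on the torus

For the deterministic hard-sphere flow on `(T^d × ℝ^d)^N` (`0 < ε < 1/2`, Alexander's
construction `Alexander.fwdFlow` / `Alexander.flow`, `HardSphereAlexander`) the **expected number
of collisions in a finite time window is finite on every energy shell, and grows at most
linearly in the length of the window**:

`∫⁻_{z ∈ D_ε^N, E(z) ≤ V²/2} #{collisions of the orbit of z in [0, t]} dz ≤ C(N, d, V) · t`,

with the explicit (non-sharp) constant `C(N, d, V) = N² · (2 d V · vol B₁) · vol(B̄_V)^N`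
(`lintegral_collisionCount_shell_le`). This is the integrability input of every collision-sum law
of large numbers / Campbell formula for the hard-sphere gas (Cercignani–Illner–Pulvirenti 1994
§4.2, App. 4.A: special-flow representation over the collision boundary, whose ceiling function
has mean `vol / flux`; Gallagher–Saint-Raymond–Texier 2013, proof of Prop. 4.1.1). The sharp
constant (the total outgoing flux of the shell, Kac / Ambrose–Kakutani) is not proved here.

The proof is the window bookkeeping of GST 2013, proof of Prop. 4.1.1, run for the *count* of
collisions (`HardSphereWindowCollisionCount`): with `δ = t/(m+1)` and `r = 2Vδ`, on the survivors
`iterGood m` the count up to time `t` is at most the number of window-starts at which some pair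
is `r`-close to contact; the flow does not lose volume on the survivors
(`volume_iterGood_inter_preimage_le`) and an `r`-close pair costs volume
`≤ d r vol B₁ · vol(B̄_V)^N` (`volume_closePair_inter_le`), so the truncated count `min(#, K)` has
integral `≤ K (m+1) · windowLoss + (m+1) N² d (2Vδ) vol B₁ vol(B̄_V)^N`
(`lintegral_min_collisionCount_shell_le_of_mesh`); as `m → ∞` the first term vanishes
(`tendsto_windowLoss`) and the second is `C · t`; monotone convergence in `K` removes the
truncation (`lintegral_collisionCount_shell_le`).

Corollaries: the same bound for the Liouville measure restricted to an energy shell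
(`lintegral_collisionCount_le_liouville`) and, for any hard-sphere flow structure `Φ` on the
torus, for the number of collision times of the orbit `s ↦ Φ_s z` in `(0, t]`
(`HardSphereFlow.lintegral_ncard_collisionTimes_Ioc_le`; the orbit of a good datum is the
algorithmic orbit, `IsHardSphereTrajectory.fwdFlow_apply_zero`, and its positive contact times
are instants, so `#(collisionTimes ∩ (0, t]) ≤ collisionCount`,
`HardSphereFlow.ncard_collisionTimes_Ioc_le_collisionCount`).

## Mathlib / Literature reuse

`HardSphereWindowCollisionCount` (this bound's bookkeeping), `HardSphereAlexander` (`iterGood`,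
`windowLoss`, `volume_shell_diff_iterGood_le`, `tendsto_windowLoss`, `eventually_chart`),
`HardSphereTorusMeasure` (`closePair`, `volume_closePair_inter_le`, `velBall`),
`HardSphereFlowOrbits` (`instantSet`), `HardSphereFlowGroup` (`fwdFlow_apply_zero`),
`HardSphereWindowCount` (`le_collisionCount_iff`). Mathlib: `lintegral_iSup`, `ge_of_tendsto`,
`lintegral_finsetSum`.

## References

* C. Cercignani, R. Illner, M. Pulvirenti, *The Mathematical Theory of Dilute Gases*, Springer
  (1994), §4.2, App. 4.A pp. 107–111.
* I. Gallagher, L. Saint-Raymond, B. Texier, *From Newton to Boltzmann: hard spheres and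
  short-range potentials*, EMS (2013), arXiv:1208.5753, §4.1, proof of Prop. 4.1.1 (p. 19).
-/

open Set Filter Topology Function MeasureTheory Metric
open scoped ENNReal

namespace Literature.Analysis.FluidPDE

noncomputable section

section Kinetic

namespace Alexander

variable {d : Type*} [Fintype d] {N : ℕ}

/-! ## The collision intensity bound -/

section Intensity

variable {ε V : ℝ}

variable (N) in
/-- The set of configurations with some ordered pair `r`-close to contact. [folklore] -/
theorem measurableSet_iUnion_closePair (ε r : ℝ) :
    MeasurableSet (⋃ (p : Fin N × Fin N) (_ : p.1 < p.2), closePair N d ε r p.1 p.2) :=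
  MeasurableSet.iUnion fun p => MeasurableSet.iUnion fun _ => measurableSet_closePair ε r p.1 p.2

/-- **An `r`-close pair in the velocity ball costs volume `N² · (d r vol B₁) · vol(B̄_V)^N`.**
[cite: GST2013, Lemma 4.1.2] -/
theorem volume_iUnion_closePair_inter_velBall_le (hε : 0 < ε) {r : ℝ} (hr : 0 ≤ r)
    (h : ε + r < 1 / 2) (V : ℝ) :
    volume ((⋃ (p : Fin N × Fin N) (_ : p.1 < p.2), closePair N d ε r p.1 p.2) ∩
        velBall N d (UnitAddTorus d) V) ≤
      (N : ℝ≥0∞) ^ 2 * (ENNReal.ofReal (Fintype.card d * r) *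
        volume (Metric.ball (0 : EuclideanSpace ℝ d) 1) *
          volume (Metric.closedBall (0 : EuclideanSpace ℝ d) V) ^ N) := by
  set C := ENNReal.ofReal (Fintype.card d * r) * volume (Metric.ball (0 : EuclideanSpace ℝ d) 1) *
    volume (Metric.closedBall (0 : EuclideanSpace ℝ d) V) ^ N with hC
  rw [iUnion_inter]
  refine (measure_iUnion_fintype_le _ _).trans ?_
  have hle : ∀ p : Fin N × Fin N, volume ((⋃ (_ : p.1 < p.2), closePair N d ε r p.1 p.2) ∩
      velBall N d (UnitAddTorus d) V) ≤ C := by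
    intro p
    by_cases hp : p.1 < p.2
    · have key := volume_closePair_inter_le (d := d) (N := N) hε hr h hp.ne MeasurableSet.univ
        (fun _ _ _ => mem_univ _) V
      rw [inter_univ, univ_inter, volume_velBall] at key
      exact (measure_mono (inter_subset_inter_left _ (iUnion_subset fun _ => Subset.rfl))).trans key
    · have hempty : (⋃ (_ : p.1 < p.2), closePair N d ε r p.1 p.2) = ∅ :=
        iUnion_eq_empty.2 fun h' => (hp h').elim
      rw [hempty, empty_inter, measure_empty]
      exact bot_le
  calc ∑ p : Fin N × Fin N, volume ((⋃ (_ : p.1 < p.2), closePair N d ε r p.1 p.2) ∩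
          velBall N d (UnitAddTorus d) V)
      ≤ ∑ _p : Fin N × Fin N, C := Finset.sum_le_sum fun p _ => hle p
    _ = (N : ℝ≥0∞) ^ 2 * C := by
        rw [Finset.sum_const, Finset.card_univ, Fintype.card_prod, Fintype.card_fin, nsmul_eq_mul]
        push_cast; ring

/-- **The truncated count at mesh `t/(m+1)`**: for `K : ℕ` and `m` with the chart condition,
`∫⁻_{shell} min(#coll[0,t], K) ≤ K (m+1) · windowLoss + C(N,d,V) · t`. [cite: GST2013, proof of Prop. 4.1.1 p. 19] -/
theorem lintegral_min_collisionCount_shell_le_of_mesh (hε : 0 < ε) (hV0 : 0 ≤ V) {t : ℝ}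
    (ht : 0 ≤ t) (K m : ℕ) (hch : ε + 2 * (2 * V * (t / ((m : ℝ) + 1))) < 2⁻¹) :
    ∫⁻ z in {z | z ∈ hardSphereDomain (Torus.geometry d) N ε ∧ configEnergy z ≤ V ^ 2 / 2},
        min (collisionCount (Torus.geometry d) ε z t : ℝ≥0∞) K ∂volume ≤
      (K : ℝ≥0∞) * (((m : ℝ≥0∞) + 1) * windowLoss (d := d) N (t / ((m : ℝ) + 1)) V) +
        (N : ℝ≥0∞) ^ 2 * (ENNReal.ofReal (Fintype.card d * (2 * V)) *
          volume (Metric.ball (0 : EuclideanSpace ℝ d) 1) *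
            volume (Metric.closedBall (0 : EuclideanSpace ℝ d) V) ^ N) * ENNReal.ofReal t := by
  -- notation
  set δ : ℝ := t / ((m : ℝ) + 1) with hδ_def
  have hm : (0 : ℝ) < (m : ℝ) + 1 := by positivity
  have hδ : 0 ≤ δ := div_nonneg ht hm.le
  have hT : ((m : ℝ) + 1) * δ = t := by rw [hδ_def]; field_simp
  have hr0 : 0 ≤ 2 * V * δ := by positivity
  have hε' : ε < 2⁻¹ := by linarith
  have h12 : ε + 2 * V * δ < 1 / 2 := by
    have : (2⁻¹ : ℝ) = 1 / 2 := by norm_num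
    linarith
  have hG := Torus.isHardSphereRegular_geometry (d := d) hε'
  have hGm : (Torus.geometry d).IsMeasurable := Torus.isMeasurable_geometry
  set S : Set (Config N d (UnitAddTorus d)) :=
    {z | z ∈ hardSphereDomain (Torus.geometry d) N ε ∧ configEnergy z ≤ V ^ 2 / 2} with hS_def
  have hSm : MeasurableSet S :=
    (measurableSet_hardSphereDomain _ Torus.measurable_geometry_sepVec N ε).inter
      (measurableSet_energyShell _)
  set H : Set (Config N d (UnitAddTorus d)) :=
    ⋃ (p : Fin N × Fin N) (_ : p.1 < p.2), closePair N d ε (2 * V * δ) p.1 p.2 with hH_def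
  have hHsub : ∀ p : Fin N × Fin N, p.1 < p.2 → hitPiece N ε (2 * V * δ) δ p.1 p.2 ⊆ H :=
    fun p hp z hz => mem_iUnion₂.2 ⟨p, hp, hitPiece_subset_closePair _ _ _ _ _ hz⟩
  set B : Set (Config N d (UnitAddTorus d)) := H ∩ velBall N d (UnitAddTorus d) V with hB_def
  have hBm : MeasurableSet B := (measurableSet_iUnion_closePair N ε _).inter (measurableSet_velBall V)
  set I : Set (Config N d (UnitAddTorus d)) := iterGood N ε δ V m with hI_def
  have hIm : MeasurableSet I := measurableSet_iterGood hε' δ V m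
  set A : ℕ → Set (Config N d (UnitAddTorus d)) := fun w =>
    {z | z ∈ I ∧ fwdFlow (Torus.geometry d) ε z ((w : ℝ) * δ) ∈ B} with hA_def
  have hAm : ∀ w, MeasurableSet (A w) := fun w =>
    hIm.inter (measurable_fwdFlow hG hGm _ hBm)
  -- pointwise bound on the shell
  have hpt : ∀ z ∈ S, min (collisionCount (Torus.geometry d) ε z t : ℝ≥0∞) K ≤
      (K : ℝ≥0∞) * (S \ I).indicator (fun _ => (1 : ℝ≥0∞)) z +
        ∑ w ∈ Finset.range (m + 1), (A w).indicator (fun _ => (1 : ℝ≥0∞)) z := by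
    intro z hzS
    by_cases hzI : z ∈ I
    · have hcount := collisionCount_le_sum_indicator_of_mem_iterGood hε hch hV0 hδ hHsub m hzI
      rw [hT] at hcount
      refine (min_le_left _ _).trans (hcount.trans ?_)
      refine le_add_left (Finset.sum_le_sum fun w _ => ?_)
      by_cases hw : fwdFlow (Torus.geometry d) ε z ((w : ℝ) * δ) ∈ H
      · have hvel : fwdFlow (Torus.geometry d) ε z ((w : ℝ) * δ) ∈ velBall N d (UnitAddTorus d) V := by
          refine setOf_configEnergy_le_subset_velBall hV0 ?_
          rw [mem_setOf_eq, configEnergy_fwdFlow]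
          exact hzI.1
        rw [indicator_of_mem hw, indicator_of_mem (show z ∈ A w from ⟨hzI, hw, hvel⟩)]
      · rw [indicator_of_notMem hw]
        exact bot_le
    · refine (min_le_right _ _).trans ?_
      rw [indicator_of_mem (show z ∈ S \ I from ⟨hzS, hzI⟩), mul_one]
      exact le_self_add
  -- integrate
  have hint : ∫⁻ z in S, min (collisionCount (Torus.geometry d) ε z t : ℝ≥0∞) K ∂volume ≤
      (K : ℝ≥0∞) * volume (S \ I) + ∑ w ∈ Finset.range (m + 1), volume (A w) := by
    calc ∫⁻ z in S, min (collisionCount (Torus.geometry d) ε z t : ℝ≥0∞) K ∂volume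
        ≤ ∫⁻ z in S, ((K : ℝ≥0∞) * (S \ I).indicator (fun _ => (1 : ℝ≥0∞)) z +
            ∑ w ∈ Finset.range (m + 1), (A w).indicator (fun _ => (1 : ℝ≥0∞)) z) ∂volume :=
          setLIntegral_mono' hSm fun z hz => hpt z hz
      _ ≤ ∫⁻ z, ((K : ℝ≥0∞) * (S \ I).indicator (fun _ => (1 : ℝ≥0∞)) z +
            ∑ w ∈ Finset.range (m + 1), (A w).indicator (fun _ => (1 : ℝ≥0∞)) z) ∂volume :=
          lintegral_mono' Measure.restrict_le_self le_rfl
      _ = (K : ℝ≥0∞) * volume (S \ I) + ∑ w ∈ Finset.range (m + 1), volume (A w) := by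
          rw [lintegral_add_left (((measurable_const.indicator (hSm.diff hIm))).const_mul _),
            lintegral_const_mul _ (measurable_const.indicator (hSm.diff hIm)),
            lintegral_finsetSum _ fun w _ => measurable_const.indicator (hAm w)]
          congr 1
          · rw [show (fun z => (S \ I).indicator (fun _ => (1 : ℝ≥0∞)) z) = (S \ I).indicator 1 from rfl,
              lintegral_indicator_one (hSm.diff hIm)]
          · refine Finset.sum_congr rfl fun w _ => ?_
            rw [show (fun z => (A w).indicator (fun _ => (1 : ℝ≥0∞)) z) = (A w).indicator 1 from rfl,
              lintegral_indicator_one (hAm w)]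
  -- the two volumes
  have hloss : volume (S \ I) ≤ ((m : ℝ≥0∞) + 1) * windowLoss (d := d) N δ V :=
    volume_shell_diff_iterGood_le hε hch hV0 hδ m
  have hB : volume B ≤ (N : ℝ≥0∞) ^ 2 * (ENNReal.ofReal (Fintype.card d * (2 * V * δ)) *
      volume (Metric.ball (0 : EuclideanSpace ℝ d) 1) *
        volume (Metric.closedBall (0 : EuclideanSpace ℝ d) V) ^ N) :=
    volume_iUnion_closePair_inter_velBall_le hε hr0 h12 V
  have hAw : ∀ w ∈ Finset.range (m + 1), volume (A w) ≤ volume B := fun w hw =>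
    volume_iterGood_inter_preimage_windowStart_le hε hch hV0 hδ
      (Nat.lt_succ_iff.1 (Finset.mem_range.1 hw)) hBm
  have hsum : ∑ w ∈ Finset.range (m + 1), volume (A w) ≤
      (N : ℝ≥0∞) ^ 2 * (ENNReal.ofReal (Fintype.card d * (2 * V)) *
        volume (Metric.ball (0 : EuclideanSpace ℝ d) 1) *
          volume (Metric.closedBall (0 : EuclideanSpace ℝ d) V) ^ N) * ENNReal.ofReal t := by
    calc ∑ w ∈ Finset.range (m + 1), volume (A w)
        ≤ ∑ _w ∈ Finset.range (m + 1), volume B := Finset.sum_le_sum hAw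
      _ = ((m : ℝ≥0∞) + 1) * volume B := by
          rw [Finset.sum_const, Finset.card_range, nsmul_eq_mul]; push_cast; ring
      _ ≤ ((m : ℝ≥0∞) + 1) * ((N : ℝ≥0∞) ^ 2 * (ENNReal.ofReal (Fintype.card d * (2 * V * δ)) *
          volume (Metric.ball (0 : EuclideanSpace ℝ d) 1) *
            volume (Metric.closedBall (0 : EuclideanSpace ℝ d) V) ^ N)) := by gcongr
      _ = _ := by
          have h1 : ((m : ℝ≥0∞) + 1) = ENNReal.ofReal ((m : ℝ) + 1) := by
            rw [ENNReal.ofReal_add (by positivity) zero_le_one, ENNReal.ofReal_natCast,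
              ENNReal.ofReal_one]
          have h2 : ENNReal.ofReal (Fintype.card d * (2 * V * δ)) =
              ENNReal.ofReal (Fintype.card d * (2 * V)) * ENNReal.ofReal δ := by
            rw [← ENNReal.ofReal_mul (by positivity)]; ring_nf
          have h3 : ENNReal.ofReal ((m : ℝ) + 1) * ENNReal.ofReal δ = ENNReal.ofReal t := by
            rw [← ENNReal.ofReal_mul hm.le, hT]
          rw [h1, h2, ← h3]
          ring
  calc ∫⁻ z in S, min (collisionCount (Torus.geometry d) ε z t : ℝ≥0∞) K ∂volume
      ≤ (K : ℝ≥0∞) * volume (S \ I) + ∑ w ∈ Finset.range (m + 1), volume (A w) := hint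
    _ ≤ _ := add_le_add (by gcongr) hsum

/-- **The truncated count**: `∫⁻_{shell} min(#coll[0,t], K) ≤ C(N,d,V) · t` for every `K`
(let the mesh go to zero: `tendsto_windowLoss`). [cite: GST2013, proof of Prop. 4.1.1 p. 19] -/
theorem lintegral_min_collisionCount_shell_le (hε : 0 < ε) (hε' : ε < 2⁻¹) (hV0 : 0 ≤ V)
    {t : ℝ} (ht : 0 ≤ t) (K : ℕ) :
    ∫⁻ z in {z | z ∈ hardSphereDomain (Torus.geometry d) N ε ∧ configEnergy z ≤ V ^ 2 / 2},
        min (collisionCount (Torus.geometry d) ε z t : ℝ≥0∞) K ∂volume ≤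
      (N : ℝ≥0∞) ^ 2 * (ENNReal.ofReal (Fintype.card d * (2 * V)) *
        volume (Metric.ball (0 : EuclideanSpace ℝ d) 1) *
          volume (Metric.closedBall (0 : EuclideanSpace ℝ d) V) ^ N) * ENNReal.ofReal t := by
  set C := (N : ℝ≥0∞) ^ 2 * (ENNReal.ofReal (Fintype.card d * (2 * V)) *
    volume (Metric.ball (0 : EuclideanSpace ℝ d) 1) *
      volume (Metric.closedBall (0 : EuclideanSpace ℝ d) V) ^ N) * ENNReal.ofReal t with hC
  have hlim : Tendsto (fun m : ℕ => (K : ℝ≥0∞) * (((m : ℝ≥0∞) + 1) *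
      windowLoss (d := d) N (t / ((m : ℝ) + 1)) V) + C) atTop (𝓝 ((K : ℝ≥0∞) * 0 + C)) :=
    (ENNReal.Tendsto.const_mul (tendsto_windowLoss (d := d) (N := N) hV0 ht)
      (Or.inr (ENNReal.natCast_ne_top K))).add tendsto_const_nhds
  rw [mul_zero, zero_add] at hlim
  refine ge_of_tendsto hlim ?_
  filter_upwards [eventually_chart hε' V t] with m hm
  exact lintegral_min_collisionCount_shell_le_of_mesh hε hV0 ht K m hm

/-- **Finite collision intensity on energy shells** (CIP 1994 §4.2 / App. 4.A; GST 2013,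
proof of Prop. 4.1.1): for `0 < ε < 1/2`, `V ≥ 0`, `t ≥ 0`, the number of collisions of the
hard-sphere flow on the torus in `[0, t]` has
`∫⁻_{z ∈ D_ε^N, E(z) ≤ V²/2} #coll(z, [0, t]) dz ≤ N² (2 d V vol B₁) vol(B̄_V)^N · t`.
[cite: GST2013, proof of Prop. 4.1.1 p. 19] -/
theorem lintegral_collisionCount_shell_le (hε : 0 < ε) (hε' : ε < 2⁻¹) (hV0 : 0 ≤ V)
    {t : ℝ} (ht : 0 ≤ t) :
    ∫⁻ z in {z | z ∈ hardSphereDomain (Torus.geometry d) N ε ∧ configEnergy z ≤ V ^ 2 / 2},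
        (collisionCount (Torus.geometry d) ε z t : ℝ≥0∞) ∂volume ≤
      (N : ℝ≥0∞) ^ 2 * (ENNReal.ofReal (Fintype.card d * (2 * V)) *
        volume (Metric.ball (0 : EuclideanSpace ℝ d) 1) *
          volume (Metric.closedBall (0 : EuclideanSpace ℝ d) V) ^ N) * ENNReal.ofReal t := by
  have hG := Torus.isHardSphereRegular_geometry (d := d) hε'
  have hGm : (Torus.geometry d).IsMeasurable := Torus.isMeasurable_geometry
  have hmeas : Measurable fun z : Config N d (UnitAddTorus d) =>
      (collisionCount (Torus.geometry d) ε z t : ℝ≥0∞) :=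
    (measurable_from_nat (f := fun n : ℕ => (n : ℝ≥0∞))).comp (measurable_collisionCount hG hGm t)
  have hf : ∀ K : ℕ, Measurable fun z : Config N d (UnitAddTorus d) =>
      min (collisionCount (Torus.geometry d) ε z t : ℝ≥0∞) K := fun K => hmeas.min measurable_const
  have hmono : Monotone fun (K : ℕ) (z : Config N d (UnitAddTorus d)) =>
      min (collisionCount (Torus.geometry d) ε z t : ℝ≥0∞) K :=
    fun K K' hKK' z => min_le_min_left _ (by exact_mod_cast hKK')
  have hsup : ∀ z : Config N d (UnitAddTorus d), (collisionCount (Torus.geometry d) ε z t : ℝ≥0∞) =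
      ⨆ K : ℕ, min (collisionCount (Torus.geometry d) ε z t : ℝ≥0∞) K := fun z =>
    le_antisymm (le_iSup_of_le (collisionCount (Torus.geometry d) ε z t) (by simp))
      (iSup_le fun K => min_le_left _ _)
  calc ∫⁻ z in {z | z ∈ hardSphereDomain (Torus.geometry d) N ε ∧ configEnergy z ≤ V ^ 2 / 2},
        (collisionCount (Torus.geometry d) ε z t : ℝ≥0∞) ∂volume
      = ∫⁻ z in {z | z ∈ hardSphereDomain (Torus.geometry d) N ε ∧ configEnergy z ≤ V ^ 2 / 2},
          ⨆ K : ℕ, min (collisionCount (Torus.geometry d) ε z t : ℝ≥0∞) K ∂volume :=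
        lintegral_congr fun z => hsup z
    _ = ⨆ K : ℕ, ∫⁻ z in {z | z ∈ hardSphereDomain (Torus.geometry d) N ε ∧ configEnergy z ≤ V ^ 2 / 2},
          min (collisionCount (Torus.geometry d) ε z t : ℝ≥0∞) K ∂volume := lintegral_iSup hf hmono
    _ ≤ _ := iSup_le fun K => lintegral_min_collisionCount_shell_le hε hε' hV0 ht K

/-- **Finite collision intensity, Liouville form**: the same bound for the Liouville measure
`dZ|_{D_ε^N}` restricted to the energy shell `E ≤ V²/2`. [cite: GST2013, proof of Prop. 4.1.1 p. 19] -/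
theorem lintegral_collisionCount_le_liouville (hε : 0 < ε) (hε' : ε < 2⁻¹) (hV0 : 0 ≤ V)
    {t : ℝ} (ht : 0 ≤ t) :
    ∫⁻ z in {z | configEnergy z ≤ V ^ 2 / 2},
        (collisionCount (Torus.geometry d) ε z t : ℝ≥0∞) ∂(liouville (Torus.geometry d) N ε) ≤
      (N : ℝ≥0∞) ^ 2 * (ENNReal.ofReal (Fintype.card d * (2 * V)) *
        volume (Metric.ball (0 : EuclideanSpace ℝ d) 1) *
          volume (Metric.closedBall (0 : EuclideanSpace ℝ d) V) ^ N) * ENNReal.ofReal t := by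
  have hset : {z : Config N d (UnitAddTorus d) | configEnergy z ≤ V ^ 2 / 2} ∩
      hardSphereDomain (Torus.geometry d) N ε =
      {z | z ∈ hardSphereDomain (Torus.geometry d) N ε ∧ configEnergy z ≤ V ^ 2 / 2} := by
    ext z; simp only [mem_inter_iff, mem_setOf_eq]; tauto
  rw [liouville_eq, Measure.restrict_restrict (measurableSet_energyShell _), hset]
  exact lintegral_collisionCount_shell_le hε hε' hV0 ht

end Intensity

end Alexander

/-! ## The bound for a hard-sphere flow structure on the torus -/

namespace HardSphereFlow

variable {d : Type*} [Fintype d] {N : ℕ} {ε : ℝ}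

/-- On the good set of a hard-sphere flow on the torus, the collision times of the orbit
`s ↦ Φ_s z` in `(0, t]` are at most as many as the collisions counted by the algorithmic flow
from `z` in `[0, t]` (the orbit is the algorithmic orbit, `IsHardSphereTrajectory.fwdFlow_apply_zero`,
whose positive contact times are instants, `FwdGood.mem_instantSet_of_fwdFlow_mem_contactSet`).
[folklore] -/
theorem ncard_collisionTimes_Ioc_le_collisionCount (hε' : ε < 2⁻¹)
    (Φ : HardSphereFlow (Torus.geometry d) ε N) {z : Config N d (UnitAddTorus d)} (hz : z ∈ Φ.good)
    (t : ℝ) :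
    (collisionTimes (Torus.geometry d) ε (fun s => Φ.flow s z) ∩ Ioc 0 t).ncard ≤
      Alexander.collisionCount (Torus.geometry d) ε z t := by
  have hG := Torus.isHardSphereRegular_geometry (d := d) hε'
  have hγ : IsHardSphereTrajectory (Torus.geometry d) ε N fun s => Φ.flow s z := Φ.isTrajectory z hz
  have h0 : Φ.flow 0 z = z := Φ.flow_zero z hz
  have hgood : Alexander.FwdGood (Torus.geometry d) ε z := by
    have h := hγ.fwdGood_apply_zero hG
    beta_reduce at h
    rwa [h0] at h
  set c := Alexander.collisionCount (Torus.geometry d) ε z t with hc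
  have hsub : collisionTimes (Torus.geometry d) ε (fun s => Φ.flow s z) ∩ Ioc 0 t ⊆
      (fun k : ℕ => (Alexander.collisionInstant (Torus.geometry d) ε z k).toReal) ''
        (Finset.Icc 1 c : Set ℕ) := by
    rintro u ⟨hu, hu0, hut⟩
    obtain ⟨i, j, hij, hcz⟩ := mem_collisionTimes.1 hu
    have hflow : Φ.flow u z = Alexander.fwdFlow (Torus.geometry d) ε z u := by
      have h := hγ.fwdFlow_apply_zero hG hu0.le
      beta_reduce at h
      rw [h0] at h
      exact h.symm
    rw [hflow] at hcz
    obtain ⟨-, k, hk, hku⟩ := hgood.mem_instantSet_of_fwdFlow_mem_contactSet hu0 hij hcz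
    refine ⟨k, ?_, ?_⟩
    · rw [Finset.coe_Icc, mem_Icc]
      refine ⟨hk, (Alexander.le_collisionCount_iff hgood).2 ?_⟩
      rw [hku]
      exact ENNReal.ofReal_le_ofReal hut
    · change (Alexander.collisionInstant (Torus.geometry d) ε z k).toReal = u
      rw [hku, ENNReal.toReal_ofReal hu0.le]
  calc (collisionTimes (Torus.geometry d) ε (fun s => Φ.flow s z) ∩ Ioc 0 t).ncard
      ≤ ((fun k : ℕ => (Alexander.collisionInstant (Torus.geometry d) ε z k).toReal) ''
          (Finset.Icc 1 c : Set ℕ)).ncard :=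
        ncard_le_ncard hsub ((Finset.Icc 1 c).finite_toSet.image _)
    _ ≤ (Finset.Icc 1 c : Set ℕ).ncard := ncard_image_le (Finset.Icc 1 c).finite_toSet
    _ = c := by rw [ncard_coe_finset, Nat.card_Icc]; omega

/-- **Finite collision intensity for a hard-sphere flow on the torus** (CIP 1994 §4.2 /
App. 4.A; GST 2013, proof of Prop. 4.1.1): for any hard-sphere flow structure `Φ` on
`(T^d × ℝ^d)^N` with `0 < ε < 1/2`, the number of collision times of the orbit in `(0, t]` has
`∫⁻_{E ≤ V²/2} #(collisionTimes ∩ (0, t]) d(liouville) ≤ N² (2 d V vol B₁) vol(B̄_V)^N · t` — in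
particular it is Liouville-integrable on every energy shell. [cite: GST2013, proof of Prop. 4.1.1 p. 19] -/
theorem lintegral_ncard_collisionTimes_Ioc_le (hε : 0 < ε) (hε' : ε < 2⁻¹)
    (Φ : HardSphereFlow (Torus.geometry d) ε N) {V : ℝ} (hV0 : 0 ≤ V) {t : ℝ} (ht : 0 ≤ t) :
    ∫⁻ z in {z | configEnergy z ≤ V ^ 2 / 2},
        ((collisionTimes (Torus.geometry d) ε (fun s => Φ.flow s z) ∩ Ioc 0 t).ncard : ℝ≥0∞)
          ∂(liouville (Torus.geometry d) N ε) ≤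
      (N : ℝ≥0∞) ^ 2 * (ENNReal.ofReal (Fintype.card d * (2 * V)) *
        volume (Metric.ball (0 : EuclideanSpace ℝ d) 1) *
          volume (Metric.closedBall (0 : EuclideanSpace ℝ d) V) ^ N) * ENNReal.ofReal t := by
  refine le_trans (lintegral_mono_ae ?_) (Alexander.lintegral_collisionCount_le_liouville hε hε' hV0 ht)
  filter_upwards [ae_restrict_of_ae Φ.ae_mem_good] with z hz
  exact_mod_cast ncard_collisionTimes_Ioc_le_collisionCount hε' Φ hz t

end HardSphereFlow

end Kinetic

end

end Literature.Analysis.FluidPDE
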